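import Summits.BirchSwinnertonDyer.BirchSwinnertonDyer.Theorems.AlignedTransportAtTwoMainConjectureOfRankZeroBSDAtTwoHalfDescentKato
import HarnessLib

/-!
# Route `AlignedTransportAtTwo`, crux C2 `MainConjectureOfRankZeroBSDAtTwo` (stmt-BirchSwinnertonDyer-22298):
# KATO IN HALF-DEGREE COORDINATES, III — THE DEFECT POLYNOMIAL `r = h_G / h_F ≡ (Y − 2)^d (mod p)` of a Kato pair, its values,
# and THE CONSERVATION LAW `ord_p G(0) + μ(F) + k_F·ord_p 2 = ord_p F(0) + μ(G) + k_G·ord_p 2 + ord_p r(2)` (any `p`)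

HONEST FRAMING (cell `bsd-f1-sign2`, WIDTH-5 attached prover seat `bsd-line-att-p5` gen 52 on line `birth` of the lead `bsd-line-att-p2`;
`--supports` stmt-BirchSwinnertonDyer-22298, closes nothing; BSD is NOT proved by any of this; the crux C2, its verdict «blocked-on
`Rank1Residual.GreenbergMuConjectureIrreducible`» and every registered stub (P / T / Kμ / LimDoor / MuIneqʳ / PFμ⁺) are untouched). THEOREMS ONLY —
pure algebra of `Λ = ℤ_p⟦T⟧`, any prime `p`; no `def`, no instance, no named fact, no `sorry`. Sequel of `…HalfDescentDivisibility` (the transform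
reflects divisibility) and `…HalfDescentKato` (`F ∣ p^a·G ⟹ k_F ≤ k_G ∧ h_F ∣ h_G`).

THE POINT. For a Kato pair `F ∣ p^a·G` of `ι`-stable elements in g51's normal form (`P = (T+2)^k·(1+T)^m·h(γ+γ⁻¹)`), the analytic-over-algebraic
quotient of the real counterparts is ONE monic polynomial **`r ∈ ℤ_p[Y]`, `h_G = h_F·r`, `deg r = d = m_G − m_F`, `r ≡ (Y − 2)^d (mod p)`** — the
DEFECT POLYNOMIAL (`exists_defect_of_dvd_C_pow_mul`; `defect_monic_natDegree_map`). Its values: **`r(c) ≡ (c − 2)^d (mod p)`**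
(`dvd_eval_sub_pow_of_map_eq`), so a positive-degree defect is VISIBLE (`p ∣ r(c)`) at every `c ≡ 2 (mod p)` — at `p = 2`: at EVERY EVEN `c`, i.e. at the
weight point `c = 2`, the twin point `c = −2` and the layer-`2` point `c = 0` AT ONCE (`dvd_eval_of_map_eq_of_dvd_sub`, `two_dvd_eval_of_map_eq`) — and
INVISIBLE (`r(c) ∈ ℤ_pˣ`) at every other `c` (`isUnit_eval_of_map_eq_of_not_dvd_sub`). THE CONSERVATION LAW (`conservation_law`; `constantCoeff_eq_of_twistZero`:
`F(0) = p^μ·2^k·h(2)·unit`): **`ord_p G(0) + μ(F) + k_F·ord_p 2 = ord_p F(0) + μ(G) + k_G·ord_p 2 + ord_p r(2)`**. Hence on a WEIGHT-CERTIFIED Kato pair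
(`ord_p F(0) = ord_p G(0)`; for C2: `f_X(0) ~ L₂(0)`, Greenberg's Thm. 4.1 + the BSD₂ formula in rank `0`) ★★★ `mu_le_and_mu_eq_iff_of_weightCertified`:
**`μ(G) ≤ μ(F)`, and `μ(F) = μ(G) ⟺ (k_F, h_F) = (k_G, h_G) ⟺ P_F = P_G`**, in which case `(F) = (G)`; i.e. `μ(F) − μ(G) = (k_G − k_F)·ord_p 2 + ord_p r(2)`:
every excess twist zero and every degree of defect is PAID FOR in `μ`. Reading for C2 on a BSD₂-certified rank-`0` seed (`F = f_X`, `G` the Néron lift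
of `L₂(f, α)` with `μ(G) = 0`): Greenberg's `μ_alg = 0` ⟺ `(k, h)_alg = (k, h)_an` (the lineage's `mu_eq_zero_iff_lambda_eq_lam` split into its
two coordinates), and `μ_alg = (k_an − k_alg) + ord₂ r(2)`. Memo `Cruxes/MainConjectureOfRankZeroBSDAtTwo/KATO-COORDINATES-att-p5-g52.md`.
BSD is not proved by any of this; nothing about any curve is asserted here.

References: R. Greenberg, V. Vatsal, Invent. Math. 142 (2000) pp. 2–4 [GreenbergVatsal2000]; R. Greenberg, LNM 1716 (1999) Thm. 4.1, p. 180
[GreenbergLNM1716]; K. Kato, Astérisque 295 (2004) Thm. 17.4 [Kato2004Asterisque]; L. Washington, GTM 83, §7.1 [Washington1997]; M. Goresky,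
Y.-S. Tai, arXiv:1701.07742, App. §16.2 Prop. 36 [GoreskyTai2017RealStructuresOrdinary].
-/

set_option linter.dupNamespace false
set_option autoImplicit false

noncomputable section

open scoped Classical

namespace Summit.BirchSwinnertonDyer.BirchSwinnertonDyer.Theorems.AlignedTransportAtTwoHalfDescentDefect

open Literature.Algebra.Polynomial.QPalindromicRealCounterpart
  Summit.BirchSwinnertonDyer.BirchSwinnertonDyer.Theorems.AlignedTransportAtTwoHalfDescentDivisibility
  Summit.BirchSwinnertonDyer.BirchSwinnertonDyer.Theorems.AlignedTransportAtTwoHalfDescentKato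

/-! ## §1 The defect polynomial `r = h_G / h_F`: monic, `≡ (Y − 2)^d (mod p)`, visible at every point `c ≡ 2 (mod p)` -/

section Defect

open Polynomial

variable {p : ℕ} [hp : Fact p.Prime]

/-- ★★ **THE DEFECT POLYNOMIAL.** `h₁ ∣ h₂` monic of degrees `m₁, m₂` with `h_i ≡ (Y − 2)^{m_i} (mod p)` (the real counterparts of distinguished
polynomials, `…HalfDescent.map_residue_realCounterpart`), `h₂ = h₁·r`: then `r` is MONIC of degree `d = m₂ − m₁` and **`r ≡ (Y − 2)^d (mod p)`**
(cancel `(Y−2)^{m₁}` in `𝔽_p[Y]`). [cite: Washington1997, §7.1 (distinguished polynomials)] [cite: GoreskyTai2017RealStructuresOrdinary, App. §16.2 Prop. 36 (p0036)] -/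
theorem defect_monic_natDegree_map {h₁ h₂ r : ℤ_[p][X]} {m₁ m₂ : ℕ} (hm₁ : h₁.Monic) (hd₁ : h₁.natDegree = m₁) (hm₂ : h₂.Monic)
    (hd₂ : h₂.natDegree = m₂) (hr : h₂ = h₁ * r) (hred₁ : h₁.map (IsLocalRing.residue ℤ_[p]) = (X - C 2) ^ m₁)
    (hred₂ : h₂.map (IsLocalRing.residue ℤ_[p]) = (X - C 2) ^ m₂) :
    r.Monic ∧ r.natDegree = m₂ - m₁ ∧ m₁ ≤ m₂ ∧ r.map (IsLocalRing.residue ℤ_[p]) = (X - C 2) ^ (m₂ - m₁) := by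
  have hrm : r.Monic := hm₁.of_mul_monic_left (hr ▸ hm₂)
  have hdeg : m₂ = m₁ + r.natDegree := by rw [← hd₂, hr, hm₁.natDegree_mul' hrm.ne_zero, hd₁]
  refine ⟨hrm, by omega, by omega, ?_⟩
  have h := congrArg (Polynomial.map (IsLocalRing.residue ℤ_[p])) hr
  rw [Polynomial.map_mul, hred₁, hred₂, show m₂ = m₁ + (m₂ - m₁) by omega, pow_add] at h
  exact (mul_left_cancel₀ (pow_ne_zero _ (monic_X_sub_C (2 : IsLocalRing.ResidueField ℤ_[p])).ne_zero) h).symm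

/-- **Values of the defect: `r(c) ≡ (c − 2)^d (mod p)`** for every `c ∈ ℤ_p`. [cite: Washington1997, §7.1 (distinguished polynomials)] -/
theorem dvd_eval_sub_pow_of_map_eq {r : ℤ_[p][X]} {d : ℕ} (hred : r.map (IsLocalRing.residue ℤ_[p]) = (X - C 2) ^ d) (c : ℤ_[p]) :
    (p : ℤ_[p]) ∣ r.eval c - (c - 2) ^ d := by
  have h1 : IsLocalRing.residue ℤ_[p] (r.eval c) = IsLocalRing.residue ℤ_[p] ((c - 2) ^ d) := by
    rw [← Polynomial.eval₂_hom, ← Polynomial.eval_map, hred, eval_pow, eval_sub, eval_X, eval_C, map_pow, map_sub, map_ofNat]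
  rw [← Ideal.mem_span_singleton, ← PadicInt.maximalIdeal_eq_span_p, ← IsLocalRing.residue_eq_zero_iff, map_sub, h1, sub_self]

/-- ★★ **A positive-degree defect is VISIBLE at every `c ≡ 2 (mod p)`**: `d ≥ 1`, `p ∣ c − 2` ⟹ **`p ∣ r(c)`**. At `p = 2` these are ALL EVEN
`c`: the weight point `c = 2` (`ζ = 1`), the twin point `c = −2` (`ζ = −1`) and the layer-`2` point `c = 0` (`ζ² = −1`) at once.
[cite: Washington1997, §7.1 (distinguished polynomials)] -/
theorem dvd_eval_of_map_eq_of_dvd_sub {r : ℤ_[p][X]} {d : ℕ} (hred : r.map (IsLocalRing.residue ℤ_[p]) = (X - C 2) ^ d) (hd : 1 ≤ d)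
    {c : ℤ_[p]} (hc : (p : ℤ_[p]) ∣ c - 2) : (p : ℤ_[p]) ∣ r.eval c := by
  have h1 := dvd_eval_sub_pow_of_map_eq hred c
  have h2 : (p : ℤ_[p]) ∣ (c - 2) ^ d := dvd_pow hc (by omega)
  have := h1.add h2
  rwa [sub_add_cancel] at this

/-- **… and INVISIBLE elsewhere**: `p ∤ c − 2` ⟹ `r(c)` is a unit (`r(c) ≡ (c−2)^d ≢ 0`). [cite: Washington1997, §7.1 (distinguished polynomials)] -/
theorem isUnit_eval_of_map_eq_of_not_dvd_sub {r : ℤ_[p][X]} {d : ℕ} (hred : r.map (IsLocalRing.residue ℤ_[p]) = (X - C 2) ^ d)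
    {c : ℤ_[p]} (hc : ¬ (p : ℤ_[p]) ∣ c - 2) : IsUnit (r.eval c) := by
  by_contra hu
  have hmem : r.eval c ∈ IsLocalRing.maximalIdeal ℤ_[p] := (IsLocalRing.mem_maximalIdeal _).mpr hu
  have h1 := dvd_eval_sub_pow_of_map_eq hred c
  rw [← Ideal.mem_span_singleton, ← PadicInt.maximalIdeal_eq_span_p] at h1
  have h2 : (c - 2) ^ d ∈ IsLocalRing.maximalIdeal ℤ_[p] := by
    have := Ideal.sub_mem _ hmem h1
    rwa [sub_sub_cancel] at this
  have h3 : c - 2 ∈ IsLocalRing.maximalIdeal ℤ_[p] := Ideal.IsPrime.mem_of_pow_mem inferInstance d h2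
  rw [PadicInt.maximalIdeal_eq_span_p, Ideal.mem_span_singleton] at h3
  exact hc h3

/-- `p = 2`: **a positive-degree defect is even at every even `2`-adic integer** (`c = 2, −2, 0, …`). [cite: Washington1997, §7.1 (distinguished polynomials)] -/
theorem two_dvd_eval_of_map_eq {r : ℤ_[2][X]} {d : ℕ} (hred : r.map (IsLocalRing.residue ℤ_[2]) = (X - C 2) ^ d) (hd : 1 ≤ d)
    {c : ℤ_[2]} (hc : (2 : ℤ_[2]) ∣ c) : (2 : ℤ_[2]) ∣ r.eval c := by
  have h := dvd_eval_of_map_eq_of_dvd_sub (p := 2) hred hd (c := c) (by rw [Nat.cast_ofNat]; exact dvd_sub hc (dvd_refl 2))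
  rwa [Nat.cast_ofNat] at h

end Defect

/-! ## §2 The defect of a Kato pair and the conservation law at the weight point -/

section Conservation

open PowerSeries Literature.NumberTheory.EllipticCurves
  Literature.NumberTheory.EllipticCurves.IwasawaAlgebra
  Summit.BirchSwinnertonDyer.Rank1Residual.X1.MuLambda
  Summit.BirchSwinnertonDyer.Rank1Residual.Iwasawa
  Summit.BirchSwinnertonDyer.BirchSwinnertonDyer.Theorems.AlignedTransportAtTwoHalfDescent
  Summit.BirchSwinnertonDyer.BirchSwinnertonDyer.Theorems.AlignedTransportAtTwoHalfDescentValues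

variable {p : ℕ} [hp : Fact p.Prime]

/-- A unit of `ℤ_p` has valuation `0`. [folklore] -/
private theorem valuation_eq_zero_of_isUnit {x : ℤ_[p]} (hx : IsUnit x) : x.valuation = 0 := by
  have hn : ‖x‖ = 1 := PadicInt.isUnit_iff.mp hx
  have h' := PadicInt.norm_eq_zpow_neg_valuation hx.ne_zero
  rw [hn] at h'
  have hp1 : (1 : ℝ) < p := by exact_mod_cast hp.out.one_lt
  have h3 : (p : ℝ) ^ (-(x.valuation : ℤ)) = (p : ℝ) ^ (0 : ℤ) := by rw [zpow_zero]; exact h'.symm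
  have := zpow_right_injective₀ (by positivity) hp1.ne' h3
  omega

/-- **The real counterpart in a normal form `P = (T+2)^k·𝒯'_m(h)` of a DISTINGUISHED `P` is `≡ (Y−2)^m (mod p)`**: the cofactor `𝒯'_m(h)` divides
`P ≡ T^{deg P} (mod p)`, so it is `≡ T^{2m}` (a monic divisor of a power of the prime `T` of `𝔽_p[T]`), i.e. distinguished; then
`…HalfDescent.map_residue_realCounterpart`. [cite: Washington1997, §7.1 (distinguished polynomials)] [cite: GoreskyTai2017RealStructuresOrdinary, App. §16.2 Prop. 36 (p0036)] -/
theorem map_residue_realCounterpart_of_twistZero {P h : Polynomial ℤ_[p]} {k m : ℕ} (hPd : P.IsDistinguishedAt (IsLocalRing.maximalIdeal ℤ_[p]))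
    (hm : h.Monic) (hd : h.natDegree = m)
    (hP : P = (Polynomial.X + Polynomial.C 2) ^ k *
      ∑ j ∈ Finset.range (m + 1), Polynomial.C (h.coeff j) * (Polynomial.X + Polynomial.C 1) ^ (m - j) *
        ((Polynomial.X + Polynomial.C 1) ^ 2 + Polynomial.C 1) ^ j) :
    h.map (IsLocalRing.residue ℤ_[p]) = (Polynomial.X - Polynomial.C 2) ^ m := by
  set A : Polynomial ℤ_[p] := ∑ j ∈ Finset.range (m + 1), Polynomial.C (h.coeff j) * (Polynomial.X + Polynomial.C 1) ^ (m - j) *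
    ((Polynomial.X + Polynomial.C 1) ^ 2 + Polynomial.C 1) ^ j with hA
  set π := IsLocalRing.residue ℤ_[p] with hπ
  obtain ⟨hAm, hAdeg⟩ := monic_twistForm hm hd
  -- `Ā ∣ T^{deg P}` in `𝔽_p[T]`, so `Ā = T^i`, and `i = 2m`
  have hPmap : P.map π = Polynomial.X ^ P.natDegree := hPd.map_eq_X_pow
  have hdvd : A.map π ∣ Polynomial.X ^ P.natDegree := by
    rw [← hPmap, hP, Polynomial.map_mul]; exact dvd_mul_left _ _
  obtain ⟨i, -, hassoc⟩ := (dvd_prime_pow (Polynomial.prime_X (R := IsLocalRing.ResidueField ℤ_[p])) _).mp hdvd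
  have hAmm : (A.map π).Monic := hAm.map π
  have hAi : A.map π = Polynomial.X ^ i := Polynomial.eq_of_monic_of_associated hAmm (Polynomial.monic_X_pow i) hassoc
  have hi : i = 2 * m := by
    have h1 := congrArg Polynomial.natDegree hAi
    rw [hAm.natDegree_map, hAdeg, Polynomial.natDegree_X_pow] at h1
    exact h1.symm
  -- hence `A` is distinguished
  have hAd : A.IsDistinguishedAt (IsLocalRing.maximalIdeal ℤ_[p]) := by
    refine ⟨⟨fun {n} hn => ?_⟩, hAm⟩
    rw [← IsLocalRing.residue_eq_zero_iff, ← hπ, ← Polynomial.coeff_map, hAi, Polynomial.coeff_X_pow, if_neg (by rw [hAdeg] at hn; omega)]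
  exact map_residue_realCounterpart hAd hAdeg hd.le (twistForm_comp_X_sub_one h m)

/-- ★★ **THE DEFECT POLYNOMIAL OF A KATO PAIR.** `F, G ∈ Λ ∖ {0}` with normal forms `P_F = (T+2)^{k_F}𝒯'(h_F)` (`k_F = ord_{−2}P_F`),
`P_G = (T+2)^{k_G}𝒯'(h_G)`, and `F ∣ p^a·G`. Then **`h_G = h_F · r`** for a MONIC `r ∈ ℤ_p[Y]` of degree `d = m_G − m_F` with **`r ≡ (Y − 2)^d (mod p)`**
— the DEFECT POLYNOMIAL of the pair; `d = 0 ⟺ r = 1 ⟺ h_F = h_G`. Reading for C2 (`F = f_X`, `G` an integral lift of `L₂(f,α)`): `h_an = h_alg · r`.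
[cite: Kato2004Asterisque, Thm. 17.4 (1)(2) (p. 273)] [cite: GreenbergVatsal2000, p. 4] [cite: Washington1997, §7.1] -/
theorem exists_defect_of_dvd_C_pow_mul {F G : IwasawaAlgebra p} (hF : F ≠ 0) (hG : G ≠ 0) {a : ℕ}
    (hdvd : F ∣ PowerSeries.C ((p : ℤ_[p]) ^ a) * G) {k₁ m₁ k₂ m₂ : ℕ} {h₁ h₂ : Polynomial ℤ_[p]} (hm₁ : h₁.Monic)
    (hd₁ : h₁.natDegree = m₁) (hm₂ : h₂.Monic) (hd₂ : h₂.natDegree = m₂)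
    (hk₁ : k₁ = ((pfree F).weierstrassDistinguished (red_pfree_ne_zero hF)).rootMultiplicity (-2))
    (hP₁ : (pfree F).weierstrassDistinguished (red_pfree_ne_zero hF) = (Polynomial.X + Polynomial.C 2) ^ k₁ *
      ∑ j ∈ Finset.range (m₁ + 1), Polynomial.C (h₁.coeff j) * (Polynomial.X + Polynomial.C 1) ^ (m₁ - j) *
        ((Polynomial.X + Polynomial.C 1) ^ 2 + Polynomial.C 1) ^ j)
    (hP₂ : (pfree G).weierstrassDistinguished (red_pfree_ne_zero hG) = (Polynomial.X + Polynomial.C 2) ^ k₂ *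
      ∑ j ∈ Finset.range (m₂ + 1), Polynomial.C (h₂.coeff j) * (Polynomial.X + Polynomial.C 1) ^ (m₂ - j) *
        ((Polynomial.X + Polynomial.C 1) ^ 2 + Polynomial.C 1) ^ j) :
    ∃ r : Polynomial ℤ_[p], h₂ = h₁ * r ∧ r.Monic ∧ r.natDegree = m₂ - m₁ ∧ m₁ ≤ m₂ ∧
      r.map (IsLocalRing.residue ℤ_[p]) = (Polynomial.X - Polynomial.C 2) ^ (m₂ - m₁) := by
  obtain ⟨⟨r, hr⟩, -, -⟩ := realCounterpart_dvd_of_dvd_C_pow_mul hF hG hdvd hm₁ hd₁ hm₂ hd₂ hk₁ hP₁ hP₂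
  have hred₁ := map_residue_realCounterpart_of_twistZero ((pfree F).isDistinguishedAt_weierstrassDistinguished (red_pfree_ne_zero hF)) hm₁ hd₁ hP₁
  have hred₂ := map_residue_realCounterpart_of_twistZero ((pfree G).isDistinguishedAt_weierstrassDistinguished (red_pfree_ne_zero hG)) hm₂ hd₂ hP₂
  exact ⟨r, hr, defect_monic_natDegree_map hm₁ hd₁ hm₂ hd₂ hr hred₁ hred₂⟩

/-- **The constant term in coordinates**: `P_F = (T+2)^k·𝒯'_m(h)` ⟹ **`F(0) = p^{μ(F)} · 2^k · h(2) · u`**, `u ∈ ℤ_pˣ` (`𝒯'_m(h)(0) = h(2)`,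
`…HalfDescentValues.eval_zero_eq`): `ord_p F(0) = μ(F) + k·ord_p 2 + ord_p h(2)`. [cite: Washington1997, §7.1 (Weierstrass preparation, uniqueness)]
[cite: GoreskyTai2017RealStructuresOrdinary, App. §16.2 (p0036)] -/
theorem constantCoeff_eq_of_twistZero {F : IwasawaAlgebra p} (hF : F ≠ 0) {h : Polynomial ℤ_[p]} {k m : ℕ} (hn : h.natDegree ≤ m)
    (hP : (pfree F).weierstrassDistinguished (red_pfree_ne_zero hF) = (Polynomial.X + Polynomial.C 2) ^ k *
      ∑ j ∈ Finset.range (m + 1), Polynomial.C (h.coeff j) * (Polynomial.X + Polynomial.C 1) ^ (m - j) *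
        ((Polynomial.X + Polynomial.C 1) ^ 2 + Polynomial.C 1) ^ j) :
    ∃ u : ℤ_[p]ˣ, PowerSeries.constantCoeff F = (p : ℤ_[p]) ^ mu F * ((2 : ℤ_[p]) ^ k * h.eval 2) * u := by
  set G := pfree F with hG
  have hred : G.map (IsLocalRing.residue ℤ_[p]) ≠ 0 := red_pfree_ne_zero hF
  have hfac : G = (G.weierstrassDistinguished hred : IwasawaAlgebra p) * G.weierstrassUnit hred :=
    G.eq_weierstrassDistinguished_mul_weierstrassUnit hred
  have hU : IsUnit (PowerSeries.constantCoeff (G.weierstrassUnit hred)) :=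
    PowerSeries.isUnit_iff_constantCoeff.mp (G.isUnit_weierstrassUnit hred)
  refine ⟨hU.unit, ?_⟩
  have hP0 : PowerSeries.constantCoeff ((G.weierstrassDistinguished hred : Polynomial ℤ_[p]) : IwasawaAlgebra p) = (2 : ℤ_[p]) ^ k * h.eval 2 := by
    rw [Polynomial.constantCoeff_coe, Polynomial.coeff_zero_eq_eval_zero, hP, Polynomial.eval_mul, Polynomial.eval_pow, Polynomial.eval_add,
      Polynomial.eval_X, Polynomial.eval_C, zero_add, eval_zero_eq hn (twistForm_comp_X_sub_one h m)]
  conv_lhs => rw [eq_C_pow_mu_mul_pfree F, ← hG, hfac]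
  rw [map_mul, map_mul, PowerSeries.constantCoeff_C, hP0, IsUnit.unit_spec]
  ring

/-- **`ord_p F(0) = μ(F) + k·ord_p 2 + ord_p h(2)`** when `F(0) ≠ 0` (valuation form of `constantCoeff_eq_of_twistZero`). [cite: Washington1997, §7.1] -/
theorem valuation_constantCoeff_eq_of_twistZero {F : IwasawaAlgebra p} (hF : F ≠ 0) (h0 : PowerSeries.constantCoeff F ≠ 0) {h : Polynomial ℤ_[p]}
    {k m : ℕ} (hn : h.natDegree ≤ m)
    (hP : (pfree F).weierstrassDistinguished (red_pfree_ne_zero hF) = (Polynomial.X + Polynomial.C 2) ^ k *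
      ∑ j ∈ Finset.range (m + 1), Polynomial.C (h.coeff j) * (Polynomial.X + Polynomial.C 1) ^ (m - j) *
        ((Polynomial.X + Polynomial.C 1) ^ 2 + Polynomial.C 1) ^ j) :
    h.eval 2 ≠ 0 ∧ (PowerSeries.constantCoeff F).valuation = mu F + k * (2 : ℤ_[p]).valuation + (h.eval 2).valuation := by
  obtain ⟨u, hu⟩ := constantCoeff_eq_of_twistZero hF hn hP
  have hh2 : h.eval 2 ≠ 0 := fun e ↦ h0 (by rw [hu, e, mul_zero, mul_zero, zero_mul])
  have h2k : (2 : ℤ_[p]) ^ k ≠ 0 := fun e ↦ h0 (by rw [hu, e, zero_mul, mul_zero, zero_mul])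
  have hpμ : (p : ℤ_[p]) ^ mu F ≠ 0 := pow_ne_zero _ (NeZero.ne _)
  refine ⟨hh2, ?_⟩
  rw [hu, PadicInt.valuation_mul (mul_ne_zero hpμ (mul_ne_zero h2k hh2)) u.ne_zero, PadicInt.valuation_mul hpμ (mul_ne_zero h2k hh2),
    PadicInt.valuation_mul h2k hh2, PadicInt.valuation_pow, PadicInt.valuation_pow, PadicInt.valuation_p, mul_one,
    valuation_eq_zero_of_isUnit u.isUnit, add_zero, add_assoc]

/-- ★★★ **THE CONSERVATION LAW AT THE WEIGHT POINT.** `F, G ∈ Λ` with `F(0) ≠ 0 ≠ G(0)`, normal forms `P_F = (T+2)^{k_F}𝒯'(h_F)` (normalised),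
`P_G = (T+2)^{k_G}𝒯'(h_G)`, `F ∣ p^a·G`, and `r` the defect (`h_G = h_F·r`). Then, in `ℕ`:
**`ord_p G(0) + μ(F) + k_F·ord_p 2 = ord_p F(0) + μ(G) + k_G·ord_p 2 + ord_p r(2)`**.
So on a WEIGHT-CERTIFIED pair (`ord_p F(0) = ord_p G(0)` — for C2: `f_X(0) ~ L₂(0)`, i.e. Greenberg's Thm. 4.1 + the BSD₂ formula in rank `0`) the
`μ`-defect pays for the twist-zero defect and the degree defect: `μ(F) − μ(G) = (k_G − k_F)·ord_p 2 + ord_p r(2)`, with `ord_p r(2) ≥ 1` as soon as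
`deg r ≥ 1` (`r(2) ≡ 0 (mod p)`). [cite: GreenbergVatsal2000, p. 4 (after Thm. (1.2))] [cite: GreenbergLNM1716, Thm. 4.1 (p. 102) and p. 180]
[cite: Kato2004Asterisque, Thm. 17.4 (1)(2) (p. 273)] -/
theorem conservation_law {F G : IwasawaAlgebra p} (hF : F ≠ 0) (hG : G ≠ 0) (hF0 : PowerSeries.constantCoeff F ≠ 0)
    (hG0 : PowerSeries.constantCoeff G ≠ 0) {k₁ m₁ k₂ m₂ : ℕ} {h₁ h₂ r : Polynomial ℤ_[p]} (hd₁ : h₁.natDegree = m₁) (hd₂ : h₂.natDegree = m₂)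
    (hP₁ : (pfree F).weierstrassDistinguished (red_pfree_ne_zero hF) = (Polynomial.X + Polynomial.C 2) ^ k₁ *
      ∑ j ∈ Finset.range (m₁ + 1), Polynomial.C (h₁.coeff j) * (Polynomial.X + Polynomial.C 1) ^ (m₁ - j) *
        ((Polynomial.X + Polynomial.C 1) ^ 2 + Polynomial.C 1) ^ j)
    (hP₂ : (pfree G).weierstrassDistinguished (red_pfree_ne_zero hG) = (Polynomial.X + Polynomial.C 2) ^ k₂ *
      ∑ j ∈ Finset.range (m₂ + 1), Polynomial.C (h₂.coeff j) * (Polynomial.X + Polynomial.C 1) ^ (m₂ - j) *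
        ((Polynomial.X + Polynomial.C 1) ^ 2 + Polynomial.C 1) ^ j)
    (hr : h₂ = h₁ * r) :
    (PowerSeries.constantCoeff G).valuation + mu F + k₁ * (2 : ℤ_[p]).valuation =
      (PowerSeries.constantCoeff F).valuation + mu G + k₂ * (2 : ℤ_[p]).valuation + (r.eval 2).valuation := by
  obtain ⟨hh₁, hvF⟩ := valuation_constantCoeff_eq_of_twistZero hF hF0 hd₁.le hP₁
  obtain ⟨hh₂, hvG⟩ := valuation_constantCoeff_eq_of_twistZero hG hG0 hd₂.le hP₂
  have hr2 : h₂.eval 2 = h₁.eval 2 * r.eval 2 := by rw [hr, Polynomial.eval_mul]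
  have hr0 : r.eval 2 ≠ 0 := fun e ↦ hh₂ (by rw [hr2, e, mul_zero])
  rw [hr2, PadicInt.valuation_mul hh₁ hr0] at hvG
  omega

/-- ★★★ **ON A WEIGHT-CERTIFIED KATO PAIR: `μ(G) ≤ μ(F)`, AND `μ(F) = μ(G)` IFF THE DISTINGUISHED POLYNOMIALS AGREE.** Same data, `ι`-stable normal forms
(`h_i` monic, `k_F = ord_{−2}P_F`, `k_G = ord_{−2}P_G`), `F ∣ p^a·G`, `ord_p F(0) = ord_p G(0)`. Then `μ(G) ≤ μ(F)`, and
**`μ(F) = μ(G) ⟺ (k_F = k_G ∧ h_F = h_G) ⟺ P_F = P_G`**; when they hold, `(F) = (G)`. Reading for C2 on a BSD₂-certified rank-`0` seed (`F = f_X`,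
`G` the Néron lift of `L₂(f,α)`, `μ(G) = 0` computable): Greenberg's `μ_alg = 0` ⟺ `(k, h)_alg = (k, h)_an` ⟺ `λ_alg = λ_an` — the lineage's
`mu_eq_zero_iff_lambda_eq_lam`, now split into the twist-zero order and the real counterpart; and `μ_alg ≥ (k_an − k_alg)·1 + ord₂ r(2)`:
EVERY excess analytic twist zero and every degree of the defect costs algebraic `μ`. [cite: GreenbergVatsal2000, p. 4 (after Thm. (1.2))]
[cite: GreenbergLNM1716, Thm. 4.1 (p. 102) and p. 180] [cite: Kato2004Asterisque, Thm. 17.4 (1)(2) (p. 273)] -/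
theorem mu_le_and_mu_eq_iff_of_weightCertified {F G : IwasawaAlgebra p} (hF : F ≠ 0) (hG : G ≠ 0) (hF0 : PowerSeries.constantCoeff F ≠ 0)
    (hG0 : PowerSeries.constantCoeff G ≠ 0) {a : ℕ} (hdvd : F ∣ PowerSeries.C ((p : ℤ_[p]) ^ a) * G)
    (hw : (PowerSeries.constantCoeff F).valuation = (PowerSeries.constantCoeff G).valuation) {k₁ m₁ k₂ m₂ : ℕ} {h₁ h₂ : Polynomial ℤ_[p]}
    (hm₁ : h₁.Monic) (hd₁ : h₁.natDegree = m₁) (hm₂ : h₂.Monic) (hd₂ : h₂.natDegree = m₂)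
    (hk₁ : k₁ = ((pfree F).weierstrassDistinguished (red_pfree_ne_zero hF)).rootMultiplicity (-2))
    (hk₂ : k₂ = ((pfree G).weierstrassDistinguished (red_pfree_ne_zero hG)).rootMultiplicity (-2))
    (hP₁ : (pfree F).weierstrassDistinguished (red_pfree_ne_zero hF) = (Polynomial.X + Polynomial.C 2) ^ k₁ *
      ∑ j ∈ Finset.range (m₁ + 1), Polynomial.C (h₁.coeff j) * (Polynomial.X + Polynomial.C 1) ^ (m₁ - j) *
        ((Polynomial.X + Polynomial.C 1) ^ 2 + Polynomial.C 1) ^ j)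
    (hP₂ : (pfree G).weierstrassDistinguished (red_pfree_ne_zero hG) = (Polynomial.X + Polynomial.C 2) ^ k₂ *
      ∑ j ∈ Finset.range (m₂ + 1), Polynomial.C (h₂.coeff j) * (Polynomial.X + Polynomial.C 1) ^ (m₂ - j) *
        ((Polynomial.X + Polynomial.C 1) ^ 2 + Polynomial.C 1) ^ j) :
    mu G ≤ mu F ∧ (mu F = mu G ↔ k₁ = k₂ ∧ h₁ = h₂) ∧
      (mu F = mu G ↔ (pfree F).weierstrassDistinguished (red_pfree_ne_zero hF) = (pfree G).weierstrassDistinguished (red_pfree_ne_zero hG)) ∧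
      (mu F = mu G → Ideal.span ({F} : Set (IwasawaAlgebra p)) = Ideal.span {G}) := by
  obtain ⟨r, hr, hrm, hrd, hle, hrmap⟩ := exists_defect_of_dvd_C_pow_mul hF hG hdvd hm₁ hd₁ hm₂ hd₂ hk₁ hP₁ hP₂
  obtain ⟨-, -, hk⟩ := realCounterpart_dvd_of_dvd_C_pow_mul hF hG hdvd hm₁ hd₁ hm₂ hd₂ hk₁ hP₁ hP₂
  have hk12 : k₁ ≤ k₂ := hk hk₂
  have hlaw := conservation_law hF hG hF0 hG0 hd₁ hd₂ hP₁ hP₂ hr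
  rw [hw] at hlaw
  -- `μ_F + k₁ v = μ_G + k₂ v + v(r(2))`
  have hlaw' : mu F + k₁ * (2 : ℤ_[p]).valuation = mu G + k₂ * (2 : ℤ_[p]).valuation + (r.eval 2).valuation := by omega
  have hkv : k₁ * (2 : ℤ_[p]).valuation ≤ k₂ * (2 : ℤ_[p]).valuation := Nat.mul_le_mul_right _ hk12
  have hμle : mu G ≤ mu F := by omega
  -- `d ≥ 1 ⟹ p ∣ r(2) ⟹ ord r(2) ≥ 1`
  have hr0 : r.eval 2 ≠ 0 := by
    obtain ⟨hh₂, -⟩ := valuation_constantCoeff_eq_of_twistZero hG hG0 hd₂.le hP₂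
    intro e; exact hh₂ (by rw [hr, Polynomial.eval_mul, e, mul_zero])
  have hdeg_pos : m₁ < m₂ → 1 ≤ (r.eval 2).valuation := fun hlt ↦ by
    have hpd : (p : ℤ_[p]) ∣ r.eval 2 := dvd_eval_of_map_eq_of_dvd_sub hrmap (by omega) (by rw [sub_self]; exact dvd_zero _)
    obtain ⟨c, hc⟩ := hpd
    have hc0 : c ≠ 0 := fun e ↦ hr0 (by rw [hc, e, mul_zero])
    rw [hc, PadicInt.valuation_mul (NeZero.ne _) hc0, PadicInt.valuation_p]; omega
  -- the key equivalence
  have hiff : mu F = mu G ↔ k₁ = k₂ ∧ h₁ = h₂ := by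
    constructor
    · intro hμ
      have hm12 : m₁ = m₂ := by
        by_contra hne
        have h1 := hdeg_pos (lt_of_le_of_ne hle hne)
        omega
      have hr1 : r = 1 := by
        rw [hm12, Nat.sub_self] at hrd
        exact Polynomial.eq_one_of_monic_natDegree_zero hrm hrd
      refine ⟨?_, by rw [hr, hr1, mul_one]⟩
      -- `k₁ = k₂`: with `h₁ = h₂` the degrees `λ = k + 2m` agree iff ... use the law: `v(r(2)) = 0` now, so `k₁ v(2) = k₂ v(2)`; at odd `p` both `k` are `0`
      rcases eq_or_ne p 2 with hp2 | hp2
      · subst hp2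
        have hv2 : (2 : ℤ_[2]).valuation = 1 := by
          have := PadicInt.valuation_p (p := 2)
          rwa [Nat.cast_ofNat] at this
        have : (r.eval 2).valuation = 0 := by rw [hr1, Polynomial.eval_one, PadicInt.valuation_one]
        rw [hv2, this] at hlaw'; omega
      · rw [hk₁, hk₂, Summit.BirchSwinnertonDyer.BirchSwinnertonDyer.Theorems.AlignedTransportAtTwoHalfDescentTwistZero.rootMultiplicity_neg_two_eq_zero_of_odd_prime hp2
          ((pfree F).isDistinguishedAt_weierstrassDistinguished (red_pfree_ne_zero hF)),
          Summit.BirchSwinnertonDyer.BirchSwinnertonDyer.Theorems.AlignedTransportAtTwoHalfDescentTwistZero.rootMultiplicity_neg_two_eq_zero_of_odd_prime hp2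
          ((pfree G).isDistinguishedAt_weierstrassDistinguished (red_pfree_ne_zero hG))]
    · rintro ⟨hk', hh'⟩
      subst hk'
      have hm12 : m₁ = m₂ := by rw [← hd₁, ← hd₂, hh']
      subst hm12
      have hr1 : r = 1 := by
        have : h₁ * r = h₁ * 1 := by rw [mul_one, ← hr, hh']
        exact mul_left_cancel₀ hm₁.ne_zero this
      have : (r.eval 2).valuation = 0 := by rw [hr1, Polynomial.eval_one, PadicInt.valuation_one]
      omega
  have hPiff : (k₁ = k₂ ∧ h₁ = h₂) ↔
      (pfree F).weierstrassDistinguished (red_pfree_ne_zero hF) = (pfree G).weierstrassDistinguished (red_pfree_ne_zero hG) := by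
    constructor
    · rintro ⟨hk', hh'⟩
      subst hk'
      have hm12 : m₁ = m₂ := by rw [← hd₁, ← hd₂, hh']
      subst hm12
      rw [hP₁, hP₂, hh']
    · intro hPP
      have hlam : lam F = lam G := by
        rw [lam_eq_natDegree_weierstrassDistinguished (eq_C_pow_mu_mul_pfree F) (red_pfree_ne_zero hF),
          lam_eq_natDegree_weierstrassDistinguished (eq_C_pow_mu_mul_pfree G) (red_pfree_ne_zero hG), hPP]
      obtain ⟨hk', -, hh'⟩ := realCounterpart_eq_of_dvd_C_pow_mul_of_lam_eq hF hG hdvd hlam hm₁ hd₁ hm₂ hd₂ hk₁ hk₂ hP₁ hP₂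
      exact ⟨hk', hh'⟩
  refine ⟨hμle, hiff, hiff.trans hPiff, fun hμ ↦ ?_⟩
  -- `(F) = (G)`: same `μ` and same distinguished polynomial
  have hPP := hPiff.mp (hiff.mp hμ)
  have hfF := (pfree F).eq_weierstrassDistinguished_mul_weierstrassUnit (red_pfree_ne_zero hF)
  have hfG := (pfree G).eq_weierstrassDistinguished_mul_weierstrassUnit (red_pfree_ne_zero hG)
  obtain ⟨u, hu⟩ := (pfree F).isUnit_weierstrassUnit (red_pfree_ne_zero hF)
  obtain ⟨v, hv⟩ := (pfree G).isUnit_weierstrassUnit (red_pfree_ne_zero hG)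
  apply Ideal.span_singleton_eq_span_singleton.mpr
  refine ⟨u⁻¹ * v, ?_⟩
  have key : ∀ A : IwasawaAlgebra p, A * ↑u * ↑(u⁻¹ * v) = A * ↑v := fun A ↦ by
    rw [Units.val_mul, ← mul_assoc, mul_assoc A, Units.mul_inv, mul_one]
  conv_rhs => rw [eq_C_pow_mu_mul_pfree G, hfG, ← hPP, ← hv, ← hμ]
  conv_lhs => rw [eq_C_pow_mu_mul_pfree F, hfF, ← hu]
  rw [← mul_assoc, key, mul_assoc]

end Conservation

end Summit.BirchSwinnertonDyer.BirchSwinnertonDyer.Theorems.AlignedTransportAtTwoHalfDescentDefect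

end
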